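import Summits.AtomisticToContinuum.HydrodynamicLimit.Theses.JParityClosure
import Literature.MathematicalPhysics.KineticTheory.EvenCollisionTubeFunctional
import Literature.MathematicalPhysics.KineticTheory.MicroscaleWindowFunctionals
import Summits.AtomisticToContinuum.HydrodynamicLimit.Theorems.JParityClosureEvenStressEnskogPreShockGlue
import Summits.AtomisticToContinuum.HydrodynamicLimit.Theorems.JParityClosureEvenStressEnskogPreShockRung0Frame

/-!
# Strategist s2 sketch (crux `JParityClosure.EvenStressEnskog`, stmt-AtomisticToContinuum-13079, 2026-08-17)

Typed census objects of `STRATEGY-CENSUS.md` (s2):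
* §Decomposition — the three children of the certified route-level BRIDGE SPLIT of `EvenStressEnskog`, as ONE-LINE fully
  qualified `Prop`s exactly as in the split kit `children.json` (census appendix A), and the `--glue-by` check: the LANDED
  `Theorems.EvenStressEnskog.evenStressEnskog_of_frameGap_of_contact_of_velocityEquilibration` (p140487) has literally the type
  `FrameGapEvenStress → ContactEvenPreShock → VelocityEquilibrationPreShock → EvenStressEnskog` (the frame gap names the parent
  decl, so the tenure restatement R turns it into `id`).  `#h21_crux_probe`: VERDICT CLEAN for all three (census appendix B).
  The gate accepted the shape but bounced the `route edit --split` on the seat-cycle rule (final cycle only) — kit ready.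
* §Transfer — `MicroRateFloor` / `StaticAvoidanceCost`: the first lemmas of crux idea `static-transfer-collision-floor`
  (what the landed `TransferInequality` CAN move to `t > 0`: anomalies whose equilibrium cost per particle is tunable).
In the published copy the namespace is `…Cruxes.EvenStressEnskog.StrategistS2` (no clash with the future route decls). -/

namespace Summit.AtomisticToContinuum.HydrodynamicLimit.Cruxes.EvenStressEnskog.StrategistS2

open Summit.AtomisticToContinuum.HydrodynamicLimit.Theses.JParityClosure

open scoped BigOperators Topology Manifold Classical MeasureTheory ProbabilityTheory Matrix InnerProductSpace ComplexConjugate ContinuousMap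
open Filter Set Function TopologicalSpace MeasureTheory

/-- support: the frame surplus of the filed `∀ τ` crux over its pre-shock, data-tied form (refers to the parent decl by name). -/
def FrameGapEvenStress : Prop :=
  (∃ η₀ : ℝ, 0 < η₀ ∧ ∀ (a₀ θ₀ : Literature.MathematicalPhysics.KineticTheory.T3 → ℝ) (u₀ : Literature.MathematicalPhysics.KineticTheory.T3 → Literature.MathematicalPhysics.KineticTheory.V3), Continuous a₀ → Continuous θ₀ → Continuous u₀ → (∀ x, 0 < a₀ x) → (∀ x, 0 < θ₀ x) → ∃ σ₀ : ℝ, 0 < σ₀ ∧ ∀ σ : ℝ, 0 < σ → σ < σ₀ → ∀ (T : ℝ) (ρ θ : ℝ → Literature.MathematicalPhysics.KineticTheory.T3 → ℝ) (u : ℝ → Literature.MathematicalPhysics.KineticTheory.T3 → Literature.MathematicalPhysics.KineticTheory.V3), Literature.MathematicalPhysics.KineticTheory.IsHardSphereEulerSolution σ T ρ u θ → ∀ Φ : (N : ℕ) → Literature.Analysis.FluidPDE.HardSphereFlow (Literature.Analysis.FluidPDE.Torus.geometry (Fin 3)) (Literature.MathematicalPhysics.KineticTheory.hsDiameter σ N)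 (N + 1), Literature.MathematicalPhysics.KineticTheory.TendstoHydroFieldsAt (fun N => Literature.MathematicalPhysics.KineticTheory.localGibbsLaw σ a₀ u₀ θ₀ N (Φ N)) Φ ρ u θ 0 → ∀ τ : ℝ, 0 < τ → τ < T → ∀ χ : ℝ × Literature.MathematicalPhysics.KineticTheory.T3 → ℝ, Continuous χ → ∀ g : ℝ → ℝ, Continuous g → (∀ a, η₀ ≤ a → g a = 0) → ∀ η δ : ℝ, 0 < η → 0 < δ → ∃ r₀ : ℝ, 0 < r₀ ∧ ∀ r : ℝ, 0 < r → r < r₀ → ∃ N₀ : ℕ, ∀ N : ℕ, N₀ ≤ N → ∀ k l : Fin 3, Literature.MathematicalPhysics.KineticTheory.localGibbsLaw σ a₀ u₀ θ₀ N (Φ N) {z | η < |Literature.MathematicalPhysics.KineticTheory.evenStat σ N (Φ N) τ χ g (Literature.MathematicalPhysics.KineticTheory.evenMark k l) r z|} ≤ ENNReal.ofReal δ) → EvenStressEnskog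

/-- crux child: the two-body core, pre-shock. -/
def ContactEvenPreShock : Prop :=
  ∃ η₀ : ℝ, 0 < η₀ ∧ ∀ (a₀ θ₀ : Literature.MathematicalPhysics.KineticTheory.T3 → ℝ) (u₀ : Literature.MathematicalPhysics.KineticTheory.T3 → Literature.MathematicalPhysics.KineticTheory.V3), Continuous a₀ → Continuous θ₀ → Continuous u₀ → (∀ x, 0 < a₀ x) → (∀ x, 0 < θ₀ x) → ∃ σ₀ : ℝ, 0 < σ₀ ∧ ∀ σ : ℝ, 0 < σ → σ < σ₀ → ∀ (T : ℝ) (ρ θ : ℝ → Literature.MathematicalPhysics.KineticTheory.T3 → ℝ) (u : ℝ → Literature.MathematicalPhysics.KineticTheory.T3 → Literature.MathematicalPhysics.KineticTheory.V3), Literature.MathematicalPhysics.KineticTheory.IsHardSphereEulerSolution σ T ρ u θ → ∀ Φ : (N : ℕ) → Literature.Analysis.FluidPDE.HardSphereFlow (Literature.Analysis.FluidPDE.Torus.geometry (Fin 3)) (Literature.MathematicalPhysics.KineticTheory.hsDiameter σ N) (N + 1), Literature.MathematicalPhysics.KineticTheory.TendstoHydroFieldsAt (fun N => Literature.MathematicalPhysics.KineticTheory.localGibbsLaw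 σ a₀ u₀ θ₀ N (Φ N)) Φ ρ u θ 0 → ∀ τ : ℝ, 0 < τ → τ < T → ∀ χ : ℝ × Literature.MathematicalPhysics.KineticTheory.T3 → ℝ, Continuous χ → ∀ g : ℝ → ℝ, Continuous g → (∀ a, η₀ ≤ a → g a = 0) → ∀ k l : Fin 3, ∀ η δ : ℝ, 0 < η → 0 < δ → ∃ r₀ : ℝ, 0 < r₀ ∧ ∀ r : ℝ, 0 < r → r < r₀ → ∃ N₀ : ℕ, ∀ N : ℕ, N₀ ≤ N → Literature.MathematicalPhysics.KineticTheory.localGibbsLaw σ a₀ u₀ θ₀ N (Φ N) {z | η < |Literature.MathematicalPhysics.KineticTheory.collisionSum σ N (Φ N) τ χ g (Literature.MathematicalPhysics.KineticTheory.evenMark k l) r z - Literature.MathematicalPhysics.KineticTheory.StationaryMicroscale.contactPredM σ N (Φ N) τ χ g (Literature.MathematicalPhysics.KineticTheory.evenMark k l) r z|} ≤ ENNReal.ofReal δ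

/-- support child: pre-shock velocity equilibration at scale r (output of the kinetic half). -/
def VelocityEquilibrationPreShock : Prop :=
  ∃ η₀ : ℝ, 0 < η₀ ∧ ∀ (a₀ θ₀ : Literature.MathematicalPhysics.KineticTheory.T3 → ℝ) (u₀ : Literature.MathematicalPhysics.KineticTheory.T3 → Literature.MathematicalPhysics.KineticTheory.V3), Continuous a₀ → Continuous θ₀ → Continuous u₀ → (∀ x, 0 < a₀ x) → (∀ x, 0 < θ₀ x) → ∃ σ₀ : ℝ, 0 < σ₀ ∧ ∀ σ : ℝ, 0 < σ → σ < σ₀ → ∀ (T : ℝ) (ρ θ : ℝ → Literature.MathematicalPhysics.KineticTheory.T3 → ℝ) (u : ℝ → Literature.MathematicalPhysics.KineticTheory.T3 → Literature.MathematicalPhysics.KineticTheory.V3), Literature.MathematicalPhysics.KineticTheory.IsHardSphereEulerSolution σ T ρ u θ → ∀ Φ : (N : ℕ) → Literature.Analysis.FluidPDE.HardSphereFlow (Literature.Analysis.FluidPDE.Torus.geometry (Fin 3)) (Literature.MathematicalPhysics.KineticTheory.hsDiameter σ N) (N + 1), Literature.MathematicalPhysics.KineticTheory.TendstoHydroFieldsAt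 (fun N => Literature.MathematicalPhysics.KineticTheory.localGibbsLaw σ a₀ u₀ θ₀ N (Φ N)) Φ ρ u θ 0 → ∀ τ : ℝ, 0 < τ → τ < T → ∀ χ : ℝ × Literature.MathematicalPhysics.KineticTheory.T3 → ℝ, Continuous χ → ∀ k : ℝ → ℝ, Continuous k → (∀ a, η₀ ≤ a → k a = 0) → ∀ F : Literature.MathematicalPhysics.KineticTheory.V3 × Literature.MathematicalPhysics.KineticTheory.V3 × ℝ → ℝ, Continuous F → (∃ C : ℝ, ∀ q, |F q| ≤ C * (1 + ‖q.1‖ ^ 2 + ‖q.2.1‖ ^ 2 + |q.2.2|)) → ∀ η δ : ℝ, 0 < η → 0 < δ → ∃ r₀ : ℝ, 0 < r₀ ∧ ∀ r : ℝ, 0 < r → r < r₀ → ∃ N₀ : ℕ, ∀ N : ℕ, N₀ ≤ N → Literature.MathematicalPhysics.KineticTheory.localGibbsLaw σ a₀ u₀ θ₀ N (Φ N) {z | η < |Literature.MathematicalPhysics.KineticTheory.StationaryMicroscale.oneBodyStat σ N (Φ N) τ χ k F r z - Literature.MathematicalPhysics.KineticTheory.StationaryMicroscale.oneBodyPred σ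 N (Φ N) τ χ k F r z|} ≤ ENNReal.ofReal δ

/-- The `--glue-by` theorem has exactly the type `C₁ → C₂ → C₃ → EvenStressEnskog` over the children as filed. -/
theorem evenStressEnskog_of_subs : FrameGapEvenStress → ContactEvenPreShock → VelocityEquilibrationPreShock → EvenStressEnskog :=
  Summit.AtomisticToContinuum.HydrodynamicLimit.Theorems.EvenStressEnskog.evenStressEnskog_of_frameGap_of_contact_of_velocityEquilibration

/-- Sanity (not vacuity): the parent implies the frame-gap child and, via the landed converse glue, is recovered from it. -/
example (h : EvenStressEnskog) : FrameGapEvenStress := fun _ => h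

/-- Inhabited frame at rung 0 (LANDED p140441): the crux child yields the untied constant-profile contact side, so the
pre-shock antecedents (classical solution + t=0 LLN) are satisfiable at constant data — the child is not vacuous. -/
example (h : ContactEvenPreShock) := Summit.AtomisticToContinuum.HydrodynamicLimit.Theorems.EvenStressEnskog.contactSideRung0_of_contactEvenPreShock h
example (h : VelocityEquilibrationPreShock) := Summit.AtomisticToContinuum.HydrodynamicLimit.Theorems.EvenStressEnskog.velocityEquilibrationRung0_of_velocityEquilibrationPreShock h


/-! ## Strategist s2, crux idea `static-transfer-collision-floor` — first lemmas (typed only; not items) -/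

/-- **MICRO RATE FLOOR (transfer lens, first lemma of the idea)**: along EVERY forward local-Gibbs evolution, every horizon, at every time
`s ≤ τ` and in every `r`-ball, all but `κ(N+1)r³` particles change velocity (collide) within the next `A·ε_N` (= O(A) mean free
times), `A = A(profiles, σ, r, κ)`; in probability as `N → ∞`.  Provable shape: TransferInequality (landed) + GibbsInvariance +
the static lemma below + union bounds over `O(N^{1/3})` grid times and finitely many balls. -/
def MicroRateFloor : Prop :=
  ∀ (a₀ θ₀ : Literature.MathematicalPhysics.KineticTheory.T3 → ℝ) (u₀ : Literature.MathematicalPhysics.KineticTheory.T3 → Literature.MathematicalPhysics.KineticTheory.V3), Continuous a₀ → Continuous θ₀ → Continuous u₀ → (∀ x, 0 < a₀ x) → (∀ x, 0 < θ₀ x) → ∃ σ₀ : ℝ, 0 < σ₀ ∧ ∀ σ : ℝ, 0 < σ → σ < σ₀ → ∀ Φ : (N : ℕ) → Literature.Analysis.FluidPDE.HardSphereFlow (Literature.Analysis.FluidPDE.Torus.geometry (Fin 3)) (Literature.MathematicalPhysics.KineticTheory.hsDiameter σ N) (N + 1), ∀ τ : ℝ, 0 < τ → ∀ r : ℝ,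 0 < r → r < 1 / 2 → ∀ κ : ℝ, 0 < κ → ∃ A : ℝ, 0 < A ∧ ∀ δ : ℝ, 0 < δ → ∃ N₀ : ℕ, ∀ N : ℕ, N₀ ≤ N → Literature.MathematicalPhysics.KineticTheory.localGibbsLaw σ a₀ u₀ θ₀ N (Φ N) {z | ∃ s ∈ Set.Icc (0 : ℝ) τ, ∃ x : Literature.MathematicalPhysics.KineticTheory.T3, κ * ((N : ℝ) + 1) * r ^ 3 < ∑ i : Fin (N + 1), (if Literature.Analysis.FluidPDE.Torus.euclidDist ((Φ N).flow s z i).1 x < r ∧ (∀ t ∈ Set.Icc s (s + A * Literature.MathematicalPhysics.KineticTheory.hsDiameter σ N), ((Φ N).flow t z i).2 = ((Φ N).flow s z i).2) then (1 : ℝ) else 0)} ≤ ENNReal.ofReal δ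

/-- **STATIC AVOIDANCE LEMMA under the homogeneous Gibbs law** (the equilibrium estimate the transfer consumes; pure stochastic geometry,
velocities i.i.d. Maxwellian independent of the hard-core positions): a set of more than `κ(N+1)r³` particles in one `r`-ball whose
STRAIGHT-LINE flights pairwise keep separation `≥ ε_N` for time `A ε_N` has probability `≤ e^{-MN}` once `A ≥ A(M, κ, r, σ, θe)` —
the anomaly cost per particle is TUNABLE in `A`, which is what lets it beat the transfer budget `e^{C(N+1)}`. -/
def StaticAvoidanceCost : Prop :=
  ∀ θe : ℝ, 0 < θe → ∃ σ₀ : ℝ, 0 < σ₀ ∧ ∀ σ : ℝ, 0 < σ → σ < σ₀ → ∀ r : ℝ, 0 < r → r < 1 / 2 → ∀ κ : ℝ, 0 < κ → ∀ M : ℝ, ∃ A : ℝ, 0 < A ∧ ∃ N₀ : ℕ, ∀ N : ℕ, N₀ ≤ N → ∀ Φ : Literature.Analysis.FluidPDE.HardSphereFlow (Literature.Analysis.FluidPDE.Torus.geometry (Fin 3)) (Literature.MathematicalPhysics.KineticTheory.hsDiameter σ N) (N + 1), Literature.MathematicalPhysics.KineticTheory.localGibbsLaw σ (fun _ => 1)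 (fun _ => 0) (fun _ => θe) N Φ {z | ∃ x : Literature.MathematicalPhysics.KineticTheory.T3, ∃ S : Finset (Fin (N + 1)), κ * ((N : ℝ) + 1) * r ^ 3 < S.card ∧ (∀ i ∈ S, Literature.Analysis.FluidPDE.Torus.euclidDist (z i).1 x < r) ∧ ∀ i ∈ S, ∀ j ∈ S, i ≠ j → ∀ t ∈ Set.Icc (0 : ℝ) (A * Literature.MathematicalPhysics.KineticTheory.hsDiameter σ N), Literature.MathematicalPhysics.KineticTheory.hsDiameter σ N ≤ ‖(Literature.Analysis.FluidPDE.Torus.geometry (Fin 3)).sepVec ((Literature.Analysis.FluidPDE.Torus.geometry (Fin 3)).translate (z i).1 (t • (z i).2)) ((Literature.Analysis.FluidPDE.Torus.geometry (Fin 3)).translate (z j).1 (t • (z j).2))‖ } ≤ ENNReal.ofReal (Real.exp (-M * N))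

end Summit.AtomisticToContinuum.HydrodynamicLimit.Cruxes.EvenStressEnskog.StrategistS2
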